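import Literature.NumberTheory.LFunctions.NoRealZeroSmallModuliII
import Literature.Barriers.RiemannHypothesis.FeketePolyaPositivitySplitPrimes
import HarnessLib

/-!
# Fekete–Pólya certificates of order two through induced characters, evaluated in the kernel
# without tables

Topic `Literature/NumberTheory/LFunctions`; namespace `Literature.NumberTheory.LFunctions.FeketePolyaKernel`.
Small computable definitions and THEOREMS (no named fact, no `sorry`): a list-free engine that certifies
`L(σ, χ) ≠ 0` on `σ > 0` for a primitive quadratic Dirichlet character `χ` of conductor `q` by checking, in
the kernel, that the second iterated partial sum `S₂(N, χ↑Q)` of an INDUCED character `χ↑Q` (`q ∣ Q`;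
the primes of `Q/q` are sifted out) is non-negative over one period `N ≤ Q` — Montgomery–Vaughan
§11.2.1 Exercise 7 (f)–(g) at `k = 2` (tree: `LFunction_re_pos_of_iterSummatory_two_nonneg`) for `χ↑Q`,
transported back to `χ` by Mathlib's `DirichletCharacter.LFunction_changeLevel` (a product of Euler
factors cannot create a zero of `L(s, χ↑Q)` out of none). Sifting small primes with `χ(p) = +1` is
Rosser's device (J. Res. NBS 1950; Chowla's induced-character conjecture, MV Exercise 8): it is what
lets `d = 53, 77, 173, 188, 197, …` pass where the primitive character fails at every order
(`Literature.Barriers.RiemannHypothesis.FeketePolyaPositivity`, Heilbronn's obstruction) or at order two.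

Unlike the table engine `FeketePolyaTables.lean` (periods `≤ 52`) everything here is computed, so that a
certificate of period `Q` costs `O(Q)` kernel steps and one line of source:
* `jacAux` / `jac` — a structurally recursive Jacobi symbol (binary reciprocity algorithm, fuel = numerator),
  `jac_eq : jac a b = J(a | b)` for odd `b > 1`;
* `valOdd q n = (n/q)`, `valFour m n = χ₋₄(n)(n/m)`, `valEightA m n = χ₋₈(n)(n/m)`,
  `valEightB m n = χ₈(n)(n/m)` — the values of the primitive quadratic characters of conductor `q` (odd
  squarefree), `4m`, `8m` (two of them), with the identification theorems `re_apply_eq_val*` for an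
  ABSTRACT primitive quadratic character (tree: `PrimitiveQuadratic.apply_natCast_eq_jacobiSym`, CRT lemmas of
  `PrimitiveQuadraticCharacterKronecker.lean`, `SmallModuli.apply_eq_tableVal_four/eight`);
* `indVal v Q`, `psum`, `psum2` — values and running sums of the induced character, bridged to the tree's
  `summatory` / `iterSummatory`;
* `run` / `runOK` — the one-pass check of `S₂ ≥ 0` over a period with its invariant `run_spec`;
* `lfunction_ne_zero_of_check` + `check_of_runOK` — the engine (the per-conductor wrappers and the
  `interval_cases` assemblies live in `NoRealZeroEvenSmallModuli.lean`).

## References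

* H. L. Montgomery, R. C. Vaughan, *Multiplicative Number Theory I*, CUP 2007, §11.2.1 Exercises 7–8,
  §9.3 Theorem 9.13. [MontgomeryVaughan2007]
* J. B. Rosser, *Real roots of real Dirichlet L-series*, J. Research Nat. Bur. Standards 45 (1950)
  505–514, §II. [Rosser1950RealRoots]
* M. Fekete, G. Pólya, Rend. Circ. Mat. Palermo 34 (1912) 89–120. [FeketePolya1912]
-/

namespace Literature.NumberTheory.LFunctions

namespace FeketePolyaKernel

open Literature.Barriers.RiemannHypothesis PrimitiveQuadratic FeketePolyaTable SmallModuli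
open scoped NumberTheorySymbols

/-! ### A structurally recursive Jacobi symbol -/

/-- `jacAux fuel a b flip`: the binary Jacobi algorithm (strip factors `4` and `2` from `a`, then flip by
reciprocity to `(b mod a, a)`), returning `J(a | b)` — negated when `flip` — for odd `b > 1`, provided
`fuel > a`. Structural recursion on `fuel` (kernel-evaluable). [cite: MontgomeryVaughan2007, §9.3 Theorem 9.13] -/
def jacAux : ℕ → ℕ → ℕ → Bool → ℤ
  | 0, _, _, _ => 0
  | fuel + 1, a, b, flip =>
    if a = 0 then 0
    else if a % 4 = 0 then jacAux fuel (a / 4) b flip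
    else if a % 2 = 0 then jacAux fuel (a / 2) b (xor (b % 8 = 3 ∨ b % 8 = 5) flip)
    else if a = 1 then (bif flip then -1 else 1)
    else jacAux fuel (b % a) a (xor (a % 4 = 3 ∧ b % 4 = 3) flip)

/-- `jac a b = J(a | b)` for odd `b > 1` (`jac_eq`). [cite: MontgomeryVaughan2007, §9.3 Theorem 9.13] -/
def jac (a b : ℕ) : ℤ := jacAux (a + 1) a b false

/-- Correctness of the binary Jacobi algorithm. [cite: MontgomeryVaughan2007, §9.3 Theorem 9.13] -/
theorem jacAux_eq : ∀ (fuel a b : ℕ) (flip : Bool), a < fuel → b % 2 = 1 → 1 < b →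
    jacAux fuel a b flip = bif flip then -J(a | b) else J(a | b) := by
  intro fuel
  induction fuel with
  | zero => intro a b flip ha; omega
  | succ fuel ih =>
    intro a b flip ha hb2 hb1
    simp only [jacAux]
    by_cases h0 : a = 0
    · subst h0
      rw [if_pos rfl, Nat.cast_zero, jacobiSym.zero_left hb1, neg_zero]
      cases flip <;> rfl
    rw [if_neg h0]
    by_cases h4 : a % 4 = 0
    · rw [if_pos h4, ih (a / 4) b flip (by omega) hb2 hb1]
      simp only [Int.natCast_ediv, Nat.cast_ofNat,
        jacobiSym.div_four_left (a := (a : ℤ)) (mod_cast h4) hb2]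
    rw [if_neg h4]
    by_cases h2 : a % 2 = 0
    · rw [if_pos h2, ih (a / 2) b _ (by omega) hb2 hb1]
      simp only [Int.natCast_ediv, Nat.cast_ofNat,
        ← jacobiSym.even_odd (a := (a : ℤ)) (mod_cast h2) hb2]
      by_cases h : b % 8 = 3 ∨ b % 8 = 5 <;> cases flip <;> simp [h]
    rw [if_neg h2]
    by_cases h1 : a = 1
    · subst h1
      rw [if_pos rfl, Nat.cast_one, jacobiSym.one_left]
    rw [if_neg h1]
    have ha2 : a % 2 = 1 := by omega
    rw [ih (b % a) a _ (lt_of_lt_of_le (Nat.mod_lt b (by omega)) (by omega)) ha2 (by omega)]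
    simp only [Int.natCast_mod, ← jacobiSym.mod_left]
    rw [← jacobiSym.quadratic_reciprocity_if ha2 hb2]
    by_cases h : a % 4 = 3 ∧ b % 4 = 3 <;> cases flip <;> simp [h]

/-- `jac a b = J(a | b)` for odd `b > 1`. [cite: MontgomeryVaughan2007, §9.3 Theorem 9.13] -/
theorem jac_eq {a b : ℕ} (hb2 : b % 2 = 1) (hb1 : 1 < b) : jac a b = J(a | b) := by
  rw [jac, jacAux_eq (a + 1) a b false (Nat.lt_succ_self a) hb2 hb1]
  rfl

/-- `J(n | m) = jac (n mod m) m` for odd `m > 1`. [cite: MontgomeryVaughan2007, §9.3 Theorem 9.13] -/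
theorem jacobiSym_eq_jac_mod {m : ℕ} (hm2 : m % 2 = 1) (hm1 : 1 < m) (n : ℕ) :
    J((n : ℤ) | m) = jac (n % m) m := by
  rw [jac_eq hm2 hm1, jacobiSym.mod_left (n : ℤ) m, Int.natCast_mod]

/-! ### Values of the primitive quadratic characters, computed -/

/-- Odd squarefree conductor `q`: `valOdd q n = (n/q)`. [cite: MontgomeryVaughan2007, §9.3 Theorem 9.13] -/
def valOdd (q n : ℕ) : ℤ := jac (n % q) q

/-- Conductor `4m`: `valFour m n = χ₋₄(n)·(n/m)`. [cite: MontgomeryVaughan2007, §9.3 Theorem 9.13] -/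
def valFour (m n : ℕ) : ℤ := tableVal [0, 1, 0, -1] n * jac (n % m) m

/-- Conductor `8m`, first pattern: `valEightA m n = χ₋₈(n)·(n/m)`. [cite: MontgomeryVaughan2007, §9.3 Theorem 9.13] -/
def valEightA (m n : ℕ) : ℤ := tableVal [0, 1, 0, 1, 0, -1, 0, -1] n * jac (n % m) m

/-- Conductor `8m`, second pattern: `valEightB m n = χ₈(n)·(n/m)`. [cite: MontgomeryVaughan2007, §9.3 Theorem 9.13] -/
def valEightB (m n : ℕ) : ℤ := tableVal [0, 1, 0, -1, 0, -1, 0, 1] n * jac (n % m) m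

/-- **Odd conductor**: `ℜχ(n) = valOdd q n = (n/q)` for a primitive quadratic `χ` mod `q` (`q` odd — hence
squarefree — and `q > 1`). [cite: MontgomeryVaughan2007, §9.3 Theorem 9.13] -/
theorem re_apply_eq_valOdd {q : ℕ} [NeZero q] (hodd : Odd q) (hq : 1 < q)
    {χ : DirichletCharacter ℂ q} (hprim : χ.IsPrimitive) (hquad : χ.IsQuadratic) (n : ℕ) :
    (χ (n : ZMod q)).re = valOdd q n := by
  have hsq := squarefree_of_isPrimitive_of_isQuadratic hodd hprim hquad
  rw [apply_natCast_eq_jacobiSym hodd hsq χ hprim hquad n, Complex.intCast_re,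
    jacobiSym_eq_jac_mod (Nat.odd_iff.mp hodd) hq n]
  rfl

/-- **Conductor `4m`**: `ℜχ(n) = valFour m n = χ₋₄(n)(n/m)` (`m` odd, `m > 1`).
[cite: MontgomeryVaughan2007, §9.3 Theorem 9.13] -/
theorem re_apply_eq_valFour {m : ℕ} [NeZero m] (hm : Odd m) (hm1 : 1 < m)
    {χ : DirichletCharacter ℂ (2 ^ 2 * m)} (hprim : χ.IsPrimitive) (hquad : χ.IsQuadratic) (n : ℕ) :
    (χ (n : ZMod (2 ^ 2 * m))).re = valFour m n := by
  have hcop := coprime_two_pow_of_odd 2 hm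
  rw [apply_natCast_eq_crtFst_mul_jacobiSym hm hprim hquad n,
    apply_eq_tableVal_four (isPrimitive_crtFst hcop hprim) (IsQuadratic.crtFst hcop hquad) n,
    ← Int.cast_mul, Complex.intCast_re, jacobiSym_eq_jac_mod (Nat.odd_iff.mp hm) hm1]
  rfl

/-- **Conductor `8m`**: `ℜχ(n)` is `valEightA m n = χ₋₈(n)(n/m)` or `valEightB m n = χ₈(n)(n/m)` (the two
primitive quadratic characters mod `8m`; `m` odd, `m > 1`). [cite: MontgomeryVaughan2007, §9.3 Theorem 9.13] -/
theorem re_apply_eq_valEight {m : ℕ} [NeZero m] (hm : Odd m) (hm1 : 1 < m)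
    {χ : DirichletCharacter ℂ (2 ^ 3 * m)} (hprim : χ.IsPrimitive) (hquad : χ.IsQuadratic) :
    (∀ n : ℕ, (χ (n : ZMod (2 ^ 3 * m))).re = valEightA m n) ∨
      (∀ n : ℕ, (χ (n : ZMod (2 ^ 3 * m))).re = valEightB m n) := by
  have hcop := coprime_two_pow_of_odd 3 hm
  rcases apply_eq_tableVal_eight (isPrimitive_crtFst hcop hprim) (IsQuadratic.crtFst hcop hquad) with
    ⟨-, hv⟩ | ⟨-, hv⟩
  · left
    intro n
    rw [apply_natCast_eq_crtFst_mul_jacobiSym hm hprim hquad n, hv n, ← Int.cast_mul, Complex.intCast_re,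
      jacobiSym_eq_jac_mod (Nat.odd_iff.mp hm) hm1]
    rfl
  · right
    intro n
    rw [apply_natCast_eq_crtFst_mul_jacobiSym hm hprim hquad n, hv n, ← Int.cast_mul, Complex.intCast_re,
      jacobiSym_eq_jac_mod (Nat.odd_iff.mp hm) hm1]
    rfl

/-- Parity test: if `ℜχ(n) = v(n)` for all `n` and `v(q − 1) = −1`, then `χ` is not even
(`χ(−1) = χ(q − 1)`). [cite: MontgomeryVaughan2007, §4.2] -/
theorem not_even_of_val {q : ℕ} [NeZero q] {χ : DirichletCharacter ℂ q} (v : ℕ → ℤ)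
    (hv : ∀ n : ℕ, (χ (n : ZMod q)).re = v n) (hneg : v (q - 1) = -1) : ¬ χ.Even := by
  intro heven
  have hq : 1 ≤ q := NeZero.one_le
  have hcast : ((q - 1 : ℕ) : ZMod q) = -1 := by
    rw [Nat.cast_sub hq, ZMod.natCast_self, Nat.cast_one, zero_sub]
  have h := hv (q - 1)
  rw [hcast, heven, Complex.one_re, hneg] at h
  norm_num at h

/-! ### The induced character: values, running sums, bridge to `summatory` / `iterSummatory` -/

/-- Values of the induced character mod `Q`: `indVal v Q n = v n` if `gcd(n, Q) = 1`, else `0`. [folklore] -/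
def indVal (v : ℕ → ℤ) (Q n : ℕ) : ℤ := if Nat.gcd n Q = 1 then v n else 0

/-- First running sum `S₁(N) = ∑_{n ≤ N} indVal v Q n`. [cite: MontgomeryVaughan2007, §11.2.1 Exercise 7] -/
def psum (v : ℕ → ℤ) (Q : ℕ) : ℕ → ℤ
  | 0 => 0
  | N + 1 => psum v Q N + indVal v Q (N + 1)

/-- Second running sum `S₂(N) = ∑_{n ≤ N} S₁(n)`. [cite: MontgomeryVaughan2007, §11.2.1 Exercise 7 (c)] -/
def psum2 (v : ℕ → ℤ) (Q : ℕ) : ℕ → ℤ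
  | 0 => 0
  | N + 1 => psum2 v Q N + psum v Q (N + 1)

/-- `ℜ χ↑Q (n) = indVal v Q n` (values of the induced character). [cite: MontgomeryVaughan2007, §11.2.1 Exercise 8] -/
theorem re_changeLevel_eq_indVal {q Q : ℕ} [NeZero Q] (hQ : q ∣ Q) (χ : DirichletCharacter ℂ q)
    (v : ℕ → ℤ) (hv : ∀ n : ℕ, (χ (n : ZMod q)).re = v n) (n : ℕ) :
    (DirichletCharacter.changeLevel hQ χ (n : ZMod Q)).re = indVal v Q n := by
  rw [re_changeLevel_apply_natCast χ hQ n, indVal]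
  by_cases hc : n.Coprime Q
  · rw [if_pos hc, if_pos (Nat.Coprime.gcd_eq_one hc), hv]
  · rw [if_neg hc, if_neg (fun h ↦ hc (Nat.coprime_iff_gcd_eq_one.2 h)), Int.cast_zero]

/-- `S₁(N, ℜχ↑Q) = psum v Q N`. [cite: MontgomeryVaughan2007, §11.2.1 Exercise 7] -/
theorem summatory_eq_psum {q Q : ℕ} [NeZero Q] (hQ : q ∣ Q) (χ : DirichletCharacter ℂ q)
    (v : ℕ → ℤ) (hv : ∀ n : ℕ, (χ (n : ZMod q)).re = v n) (N : ℕ) :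
    summatory (fun n ↦ (DirichletCharacter.changeLevel hQ χ (n : ZMod Q)).re) N = (psum v Q N : ℝ) := by
  induction N with
  | zero => simp [psum]
  | succ N ih =>
    rw [summatory_succ, ih, re_changeLevel_eq_indVal hQ χ v hv]
    simp [psum]

/-- `S₂(N, ℜχ↑Q) = psum2 v Q N`. [cite: MontgomeryVaughan2007, §11.2.1 Exercise 7 (c)] -/
theorem iterSummatory_two_eq_psum2 {q Q : ℕ} [NeZero Q] (hQ : q ∣ Q) (χ : DirichletCharacter ℂ q)
    (v : ℕ → ℤ) (hv : ∀ n : ℕ, (χ (n : ZMod q)).re = v n) (N : ℕ) :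
    iterSummatory (fun n ↦ (DirichletCharacter.changeLevel hQ χ (n : ZMod Q)).re) 2 N =
      (psum2 v Q N : ℝ) := by
  rw [show (2 : ℕ) = 0 + 1 + 1 from rfl, iterSummatory_succ, iterSummatory_succ, iterSummatory_zero]
  induction N with
  | zero => simp [psum2]
  | succ N ih =>
    rw [summatory_succ, ih, summatory_eq_psum hQ χ v hv]
    simp [psum2]

/-- The induced values are `Q`-periodic. [cite: MontgomeryVaughan2007, §11.2.1 Exercise 8] -/
theorem indVal_add_level {q Q : ℕ} [NeZero q] [NeZero Q] (hQ : q ∣ Q) (χ : DirichletCharacter ℂ q)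
    (v : ℕ → ℤ) (hv : ∀ n : ℕ, (χ (n : ZMod q)).re = v n) (n : ℕ) :
    indVal v Q (n + Q) = indVal v Q n := by
  have h := re_changeLevel_periodic χ hQ n
  rw [re_changeLevel_eq_indVal hQ χ v hv, re_changeLevel_eq_indVal hQ χ v hv] at h
  exact_mod_cast h

/-- A full period of `S₁` vanishes (`χ ≠ χ₀`). [cite: MontgomeryVaughan2007, §11.2.1 Exercise 7 (a)] -/
theorem psum_level {q Q : ℕ} [NeZero Q] (hQ : q ∣ Q) (χ : DirichletCharacter ℂ q)
    (v : ℕ → ℤ) (hv : ∀ n : ℕ, (χ (n : ZMod q)).re = v n) (hχ : χ ≠ 1) : psum v Q Q = 0 := by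
  have h := summatory_re_changeLevel_level χ hχ hQ
  rw [summatory_eq_psum hQ χ v hv] at h
  exact_mod_cast h

/-- `S₁` is `Q`-periodic. [cite: MontgomeryVaughan2007, §11.2.1 Exercise 7 (a)] -/
theorem psum_add_level {q Q : ℕ} [NeZero q] [NeZero Q] (hQ : q ∣ Q) (χ : DirichletCharacter ℂ q)
    (v : ℕ → ℤ) (hv : ∀ n : ℕ, (χ (n : ZMod q)).re = v n) (hχ : χ ≠ 1) (N : ℕ) :
    psum v Q (N + Q) = psum v Q N := by
  induction N with
  | zero => simpa [psum] using psum_level hQ χ v hv hχ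
  | succ N ih =>
    rw [show N + 1 + Q = (N + Q) + 1 by omega, psum, psum, ih, show N + Q + 1 = (N + 1) + Q by omega,
      indVal_add_level hQ χ v hv]

/-- `S₂(N + Q) = S₂(N) + S₂(Q)`. [cite: MontgomeryVaughan2007, §11.2.1 Exercise 7 (f)] -/
theorem psum2_add_level {q Q : ℕ} [NeZero q] [NeZero Q] (hQ : q ∣ Q) (χ : DirichletCharacter ℂ q)
    (v : ℕ → ℤ) (hv : ∀ n : ℕ, (χ (n : ZMod q)).re = v n) (hχ : χ ≠ 1) (N : ℕ) :
    psum2 v Q (N + Q) = psum2 v Q N + psum2 v Q Q := by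
  induction N with
  | zero => simp [psum2]
  | succ N ih =>
    rw [show N + 1 + Q = (N + Q) + 1 by omega, psum2, psum2, ih, show N + Q + 1 = (N + 1) + Q by omega,
      psum_add_level hQ χ v hv hχ]
    ring

/-- `S₂(N + kQ) = S₂(N) + k S₂(Q)`. [cite: MontgomeryVaughan2007, §11.2.1 Exercise 7 (f)] -/
theorem psum2_add_mul_level {q Q : ℕ} [NeZero q] [NeZero Q] (hQ : q ∣ Q) (χ : DirichletCharacter ℂ q)
    (v : ℕ → ℤ) (hv : ∀ n : ℕ, (χ (n : ZMod q)).re = v n) (hχ : χ ≠ 1) (k N : ℕ) :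
    psum2 v Q (N + k * Q) = psum2 v Q N + k * psum2 v Q Q := by
  induction k with
  | zero => simp
  | succ k ih =>
    rw [show N + (k + 1) * Q = (N + k * Q) + Q by ring, psum2_add_level hQ χ v hv hχ, ih]
    push_cast; ring

/-- **One period suffices**: if `S₂(j) ≥ 0` for `1 ≤ j ≤ Q` then `S₂(N) ≥ 0` for all `N` (the drift per
period is `S₂(Q) ≥ 0`, the case `j = Q`). [cite: MontgomeryVaughan2007, §11.2.1 Exercise 7 (f)] -/
theorem psum2_nonneg {q Q : ℕ} [NeZero q] [NeZero Q] (hQ : q ∣ Q) (χ : DirichletCharacter ℂ q)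
    (v : ℕ → ℤ) (hv : ∀ n : ℕ, (χ (n : ZMod q)).re = v n) (hχ : χ ≠ 1)
    (hchk : ∀ j : ℕ, 1 ≤ j → j ≤ Q → 0 ≤ psum2 v Q j) (N : ℕ) : 0 ≤ psum2 v Q N := by
  have hQ0 : 0 < Q := NeZero.pos Q
  have hN : N = N % Q + (N / Q) * Q := by rw [mul_comm]; exact (Nat.mod_add_div N Q).symm
  rw [hN, psum2_add_mul_level hQ χ v hv hχ]
  have h1 : 0 ≤ psum2 v Q (N % Q) := by
    rcases Nat.eq_zero_or_pos (N % Q) with h0 | hpos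
    · rw [h0]; simp [psum2]
    · exact hchk _ hpos (Nat.mod_lt N hQ0).le
  have h2 : 0 ≤ psum2 v Q Q := hchk Q NeZero.one_le le_rfl
  positivity

/-- **The engine.** `χ ≠ χ₀` mod `q`, `q ∣ Q`, `ℜχ(n) = v(n)`, and `S₂(j, χ↑Q) ≥ 0` for `1 ≤ j ≤ Q`: then
`L(σ, χ) ≠ 0` for every `σ > 0` (MV Exercise 7 (g) at `k = 2` for `χ↑Q`, then
`L(s, χ↑Q) = L(s, χ) ∏_{p ∣ Q}(1 − χ(p)p^{−s})`). [cite: MontgomeryVaughan2007, §11.2.1 Exercises 7 (g), 8] -/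
theorem lfunction_ne_zero_of_check {q Q : ℕ} [NeZero q] [NeZero Q] (hQ : q ∣ Q)
    (χ : DirichletCharacter ℂ q) (v : ℕ → ℤ) (hv : ∀ n : ℕ, (χ (n : ZMod q)).re = v n) (hχ : χ ≠ 1)
    (hchk : ∀ j : ℕ, 1 ≤ j → j ≤ Q → 0 ≤ psum2 v Q j) {σ : ℝ} (hσ : 0 < σ) :
    χ.LFunction (σ : ℂ) ≠ 0 := by
  have hψ : DirichletCharacter.changeLevel hQ χ ≠ 1 := fun h ↦
    hχ ((DirichletCharacter.changeLevel_eq_one_iff hQ).mp h)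
  have hpos : 0 < ((DirichletCharacter.changeLevel hQ χ).LFunction (σ : ℂ)).re := by
    refine LFunction_re_pos_of_iterSummatory_two_nonneg _ hψ (fun N _ ↦ ?_) hσ
    rw [iterSummatory_two_eq_psum2 hQ χ v hv]
    exact_mod_cast psum2_nonneg hQ χ v hv hχ hchk N
  intro h0
  have hL := DirichletCharacter.LFunction_changeLevel hQ χ (s := (σ : ℂ)) (Or.inl hχ)
  rw [h0, zero_mul] at hL
  rw [hL, Complex.zero_re] at hpos
  exact lt_irrefl _ hpos

/-! ### The one-pass check of `S₂ ≥ 0` over a period -/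

/-- `run v Q fuel t s₁ s₂`: from `s₁ = S₁(t)`, `s₂ = S₂(t)` process `n = t + 1, …, t + fuel`; return the
final `(S₁, S₂)`, or `none` as soon as some `S₂(n) < 0`. [cite: MontgomeryVaughan2007, §11.2.1 Exercise 7] -/
def run (v : ℕ → ℤ) (Q : ℕ) : ℕ → ℕ → ℤ → ℤ → Option (ℤ × ℤ)
  | 0, _, s₁, s₂ => some (s₁, s₂)
  | fuel + 1, t, s₁, s₂ =>
    if 0 ≤ s₂ + (s₁ + indVal v Q (t + 1)) then
      run v Q fuel (t + 1) (s₁ + indVal v Q (t + 1)) (s₂ + (s₁ + indVal v Q (t + 1)))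
    else none

/-- `runOK v Q`: the whole period `1 ≤ n ≤ Q` passes. [cite: MontgomeryVaughan2007, §11.2.1 Exercise 7] -/
def runOK (v : ℕ → ℤ) (Q : ℕ) : Bool := (run v Q Q 0 0 0).isSome

/-- Invariant of `run`: a successful run from `(S₁(t), S₂(t))` certifies `S₂(t + j) ≥ 0` for
`1 ≤ j ≤ fuel` and returns `(S₁(t + fuel), S₂(t + fuel))`. [cite: MontgomeryVaughan2007, §11.2.1 Exercise 7 (g)] -/
theorem run_spec (v : ℕ → ℤ) (Q : ℕ) : ∀ (fuel t : ℕ) (s₁ s₂ a b : ℤ),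
    run v Q fuel t s₁ s₂ = some (a, b) → s₁ = psum v Q t → s₂ = psum2 v Q t →
      a = psum v Q (t + fuel) ∧ b = psum2 v Q (t + fuel) ∧
        ∀ j : ℕ, 1 ≤ j → j ≤ fuel → 0 ≤ psum2 v Q (t + j) := by
  intro fuel
  induction fuel with
  | zero =>
    intro t s₁ s₂ a b h h1 h2
    simp only [run, Option.some.injEq, Prod.mk.injEq] at h
    obtain ⟨rfl, rfl⟩ := h
    exact ⟨by simpa using h1, by simpa using h2, fun j hj hj0 ↦ by omega⟩
  | succ fuel ih =>
    intro t s₁ s₂ a b h h1 h2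
    simp only [run] at h
    split_ifs at h with hok
    · have h1' : s₁ + indVal v Q (t + 1) = psum v Q (t + 1) := by rw [psum, h1]
      have h2' : s₂ + (s₁ + indVal v Q (t + 1)) = psum2 v Q (t + 1) := by rw [psum2, h2, h1']
      obtain ⟨ha, hb, hall⟩ := ih (t + 1) _ _ a b h h1' h2'
      refine ⟨by rw [ha, show t + 1 + fuel = t + (fuel + 1) by omega],
        by rw [hb, show t + 1 + fuel = t + (fuel + 1) by omega], fun j hj hjf ↦ ?_⟩
      rcases Nat.eq_or_lt_of_le hj with hj1 | hj1
      · rw [← hj1, ← h2']; exact hok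
      · have := hall (j - 1) (by omega) (by omega)
        rwa [show t + 1 + (j - 1) = t + j by omega] at this

/-- A passing period check gives `S₂(j) ≥ 0` for `1 ≤ j ≤ Q`. [cite: MontgomeryVaughan2007, §11.2.1 Exercise 7 (g)] -/
theorem check_of_runOK {v : ℕ → ℤ} {Q : ℕ} (h : runOK v Q = true) :
    ∀ j : ℕ, 1 ≤ j → j ≤ Q → 0 ≤ psum2 v Q j := by
  rw [runOK, Option.isSome_iff_exists] at h
  obtain ⟨⟨a, b⟩, hab⟩ := h
  have := (run_spec v Q Q 0 0 0 a b hab (by simp [psum]) (by simp [psum2])).2.2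
  simpa using this

/-- Sanity checks of the engine on known cases (kernel `decide`): `d = 53` fails with the primitive
character (`S₂(3) = −1`) and passes through `χ₅₃↑106`; `(52/53) = +1` (`χ₅₃` is even). [folklore] -/
example : runOK (valOdd 53) 53 = false ∧ runOK (valOdd 53) 106 = true ∧ valOdd 53 52 = 1 := by
  decide +kernel

end FeketePolyaKernel

end Literature.NumberTheory.LFunctions
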